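import Mathlib
import Summits.QuantumAdvantage.QuantumAdvantage.Theorems.MobiusLadderLiouvilleOrthogonalTC0StubCubeTail
import Summits.QuantumAdvantage.QuantumAdvantage.Theorems.MobiusLadderLiouvilleOrthogonalTC0StubKaneClaim
import HarnessLib

/-!
# Crux `MobiusLadder.LiouvilleOrthogonalTC0` (stmt-QuantumAdvantage-1393), line `Sketch`, skeleton v6:
# stub `stub_kaneSens` — Kane's Proposition 3 in counting form

For unate Boolean functions `f_0, …, f_{K-1}` on the cube `{0,1}^m` (`f_a` monotone towards the
orientation `o_a`) and `F = ⋁_a f_a`, the sensitivity count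
`sens(F) = #{(σ, j) : F(σ) ≠ F(σ^{⊕j})}` is at most `(4√(log((K+1)(m+1))) + 8)·2^m·√m` (`m ≥ 1`).

This is D. M. Kane, *The average sensitivity of an intersection of half spaces*, STOC 2014
(arXiv:1309.2987), Proposition 3, in counting form and with a crude tail: writing
`F_r = ⋁_{a<r} f_a`, `S_r = ¬F_r ∧ f_r` and `T_o(σ) = Σ_j x^o_j(σ)` (`x^o_j(σ) = ±1` according as
`σ_j = o_j` or not), Kane's one-step inequality (`stub_kaneClaim`: the pointwise claim plus the flip
involution) gives `sens(F_{r+1}) - sens(F_r) ≤ 2 Σ_{σ ∈ S_r} T_{o_r}(σ)`; for every `y ≥ 0`,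
`Σ_{σ∈S} T_o(σ) ≤ y·#S + m·#{σ : y ≤ T_o(σ)} ≤ y·#S + m·2^m·e^{-y²/(2m)}` by the Hoeffding count
on the cube (`stub_cubeTail`); the sets `S_r` are pairwise disjoint, so telescoping gives
`sens(F) ≤ 2y·2^m + 2Km·2^m·e^{-y²/(2m)}`, and `y = √(2m·log((K+1)(m+1)))` yields
`sens(F) ≤ (2√2·√log + 2)·2^m·√m ≤ (4√log + 8)·2^m·√m`. The chain `F_r` is handled abstractly
(`G_0 = 0`, `G_{r+1} = G_r ∨ g_r`) and instantiated with `G_r = [∃ a, a < r ∧ f_a]` at the end.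
-/

set_option linter.dupNamespace false -- D-0017: single-problem summit ⇒ `QuantumAdvantage.QuantumAdvantage` by design

noncomputable section

namespace Summit.QuantumAdvantage.QuantumAdvantage.Theorems.LiouvilleOrthogonalTC0

open Finset

namespace KaneSens

variable {m : ℕ}

/-! ### Telescoping Kane's one-step inequality along a chain of disjunctions -/

/-- Telescoping `stub_kaneClaim` along a chain `G_0 = 0`, `G_{r+1} = G_r ∨ g_r` of disjunctions of
unate functions `g_r` (orientations `p_r`):
`sens(G_n) ≤ 2 Σ_{r<n} Σ_σ [¬G_r σ ∧ g_r σ]·T_{p_r}(σ)`. -/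
theorem sens_chain_le (G g : ℕ → (Fin m → Bool) → Bool) (p : ℕ → Fin m → Bool)
    (hG0 : ∀ σ : Fin m → Bool, G 0 σ = false)
    (hGs : ∀ (r : ℕ) (σ : Fin m → Bool), G (r + 1) σ = (G r σ || g r σ))
    (hg : ∀ (r : ℕ) (σ : Fin m → Bool) (j : Fin m),
      g r (Function.update σ j (!p r j)) = true → g r (Function.update σ j (p r j)) = true)
    (n : ℕ) :
    (∑ σ : Fin m → Bool, ((univ.filter fun j : Fin m =>
        G n σ ≠ G n (Function.update σ j (!σ j))).card : ℝ))
      ≤ 2 * ∑ r ∈ range n, ∑ σ : Fin m → Bool, (if (!G r σ && g r σ) = true then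
          ∑ j : Fin m, (if σ j = p r j then (1 : ℝ) else -1) else 0) := by
  induction n with
  | zero => simp [hG0]
  | succ n ih =>
    have h := stub_kaneClaim (G n) (g n) (p n) (hg n)
    rw [sum_range_succ, mul_add]
    simp only [hGs]
    linarith

/-! ### The crude level-one bound and disjointness -/

/-- `T_o(σ) ≤ m`. -/
theorem tilt_le (o σ : Fin m → Bool) : ∑ j : Fin m, (if σ j = o j then (1 : ℝ) else -1) ≤ m := by
  calc ∑ j : Fin m, (if σ j = o j then (1 : ℝ) else -1)
      ≤ ∑ _j : Fin m, (1 : ℝ) := sum_le_sum fun j _ => by split_ifs <;> norm_num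
    _ = m := by simp

/-- **The crude level-one bound**: for every `S ⊆ {0,1}^m`, orientation `o` and `y ≥ 0`,
`Σ_{σ ∈ S} T_o(σ) ≤ y·#S + m·2^m·e^{-y²/(2m)}` (split at level `y`, `T_o ≤ m`, `stub_cubeTail`). -/
theorem sum_tilt_le (o : Fin m → Bool) (S : (Fin m → Bool) → Bool) (y : ℝ) (hy : 0 ≤ y) :
    ∑ σ : Fin m → Bool, (if S σ = true then
        ∑ j : Fin m, (if σ j = o j then (1 : ℝ) else -1) else 0)
      ≤ y * (((univ : Finset (Fin m → Bool)).filter fun σ => S σ = true).card : ℝ)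
        + m * (2 ^ m * Real.exp (-(y ^ 2 / (2 * m)))) := by
  have htail := stub_cubeTail m o y hy
  have hpt : ∀ σ : Fin m → Bool,
      (if S σ = true then ∑ j : Fin m, (if σ j = o j then (1 : ℝ) else -1) else 0)
        ≤ y * (if S σ = true then 1 else 0) + m * (if y ≤ ∑ j : Fin m,
            (if σ j = o j then (1 : ℝ) else -1) then 1 else 0) := by
    intro σ
    by_cases hS : S σ = true
    · rw [if_pos hS, if_pos hS, mul_one]
      by_cases hyT : y ≤ ∑ j : Fin m, (if σ j = o j then (1 : ℝ) else -1)
      · rw [if_pos hyT, mul_one]; linarith [tilt_le o σ]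
      · rw [if_neg hyT, mul_zero, add_zero]; linarith
    · rw [if_neg hS, if_neg hS, mul_zero, zero_add]
      split_ifs <;> simp
  calc ∑ σ : Fin m → Bool, (if S σ = true then
          ∑ j : Fin m, (if σ j = o j then (1 : ℝ) else -1) else 0)
      ≤ ∑ σ : Fin m → Bool, (y * (if S σ = true then 1 else 0) + m * (if y ≤ ∑ j : Fin m,
            (if σ j = o j then (1 : ℝ) else -1) then 1 else 0)) :=
        sum_le_sum fun σ _ => hpt σ
    _ = y * (((univ : Finset (Fin m → Bool)).filter fun σ => S σ = true).card : ℝ)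
          + m * (((univ : Finset (Fin m → Bool)).filter fun σ =>
              y ≤ ∑ j : Fin m, (if σ j = o j then (1 : ℝ) else -1)).card : ℝ) := by
        rw [sum_add_distrib, ← mul_sum, ← mul_sum, natCast_card_filter, natCast_card_filter]
    _ ≤ _ := by linarith [mul_le_mul_of_nonneg_left htail (Nat.cast_nonneg (α := ℝ) m)]

/-- Along the chain, each point of the cube enters exactly one set `S_r = ¬G_r ∧ g_r` (`r < n`) if
`G_n` holds there, and none otherwise. -/
theorem sum_ind_new_eq (G g : ℕ → (Fin m → Bool) → Bool)
    (hG0 : ∀ σ : Fin m → Bool, G 0 σ = false)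
    (hGs : ∀ (r : ℕ) (σ : Fin m → Bool), G (r + 1) σ = (G r σ || g r σ))
    (σ : Fin m → Bool) (n : ℕ) :
    ∑ r ∈ range n, (if (!G r σ && g r σ) = true then (1 : ℝ) else 0)
      = if G n σ = true then 1 else 0 := by
  induction n with
  | zero => simp [hG0]
  | succ n ih =>
    rw [sum_range_succ, ih, hGs]
    cases G n σ <;> cases g n σ <;> simp

/-- The sets `S_r` are pairwise disjoint: their sizes sum to at most `2^m`. -/
theorem sum_card_new_le (G g : ℕ → (Fin m → Bool) → Bool)
    (hG0 : ∀ σ : Fin m → Bool, G 0 σ = false)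
    (hGs : ∀ (r : ℕ) (σ : Fin m → Bool), G (r + 1) σ = (G r σ || g r σ)) (n : ℕ) :
    ∑ r ∈ range n, (((univ : Finset (Fin m → Bool)).filter
        fun σ => (!G r σ && g r σ) = true).card : ℝ) ≤ 2 ^ m := by
  calc ∑ r ∈ range n, (((univ : Finset (Fin m → Bool)).filter
          fun σ => (!G r σ && g r σ) = true).card : ℝ)
      = ∑ r ∈ range n, ∑ σ : Fin m → Bool,
          (if (!G r σ && g r σ) = true then (1 : ℝ) else 0) := by
        simp only [natCast_card_filter]
    _ = ∑ σ : Fin m → Bool, (if G n σ = true then (1 : ℝ) else 0) := by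
        rw [sum_comm]; exact sum_congr rfl fun σ _ => sum_ind_new_eq G g hG0 hGs σ n
    _ ≤ ∑ _σ : Fin m → Bool, (1 : ℝ) := sum_le_sum fun σ _ => by split_ifs <;> norm_num
    _ = 2 ^ m := by simp

/-! ### Kane's Proposition 3 along a chain -/

/-- **Kane's Proposition 3 (counting form, crude tail)** for the `n`-th function of a chain
`G_0 = 0`, `G_{r+1} = G_r ∨ g_r` of disjunctions of unate functions:
`sens(G_n) ≤ (4√(log((n+1)(m+1))) + 8)·2^m·√m`. -/
theorem sens_chain_bound (hm : 1 ≤ m) (G g : ℕ → (Fin m → Bool) → Bool) (p : ℕ → Fin m → Bool)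
    (hG0 : ∀ σ : Fin m → Bool, G 0 σ = false)
    (hGs : ∀ (r : ℕ) (σ : Fin m → Bool), G (r + 1) σ = (G r σ || g r σ))
    (hg : ∀ (r : ℕ) (σ : Fin m → Bool) (j : Fin m),
      g r (Function.update σ j (!p r j)) = true → g r (Function.update σ j (p r j)) = true)
    (n : ℕ) :
    (∑ σ : Fin m → Bool, ((univ.filter fun j : Fin m =>
        G n σ ≠ G n (Function.update σ j (!σ j))).card : ℝ))
      ≤ (4 * Real.sqrt (Real.log ((n + 1) * (m + 1))) + 8) * (2 ^ m * Real.sqrt m) := by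
  set L : ℝ := Real.log ((n + 1) * (m + 1)) with hL
  have hn1 : (1 : ℝ) ≤ n + 1 := by simp
  have hm1 : (1 : ℝ) ≤ m + 1 := by simp
  have hNM : (1 : ℝ) ≤ (n + 1) * (m + 1) := by nlinarith
  have hNMpos : (0 : ℝ) < (n + 1) * (m + 1) := by positivity
  have hL0 : 0 ≤ L := Real.log_nonneg hNM
  have hm0 : (0 : ℝ) < m := by exact_mod_cast hm
  have hsm : 1 ≤ Real.sqrt m := by rw [Real.one_le_sqrt]; exact_mod_cast hm
  have h2m : (0 : ℝ) < 2 ^ m := by positivity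
  -- the level `y = √(2 m L)`
  set y : ℝ := Real.sqrt 2 * Real.sqrt m * Real.sqrt L with hy
  have hy0 : 0 ≤ y := by positivity
  have hy2 : y ^ 2 / (2 * m) = L := by
    have h : y ^ 2 = 2 * m * L := by
      rw [hy, mul_pow, mul_pow, Real.sq_sqrt (by norm_num : (0 : ℝ) ≤ 2), Real.sq_sqrt hm0.le,
        Real.sq_sqrt hL0]
    rw [h]; field_simp
  have hexp : Real.exp (-(y ^ 2 / (2 * m))) = (((n : ℝ) + 1) * ((m : ℝ) + 1))⁻¹ := by
    rw [hy2, Real.exp_neg, hL, Real.exp_log hNMpos]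
  -- telescoping + level-one bound + disjointness
  have h1 := sens_chain_le G g p hG0 hGs hg n
  have h2 : ∀ r ∈ range n,
      ∑ σ : Fin m → Bool, (if (!G r σ && g r σ) = true then
          ∑ j : Fin m, (if σ j = p r j then (1 : ℝ) else -1) else 0)
        ≤ y * (((univ : Finset (Fin m → Bool)).filter
            fun σ => (!G r σ && g r σ) = true).card : ℝ)
          + m * (2 ^ m * Real.exp (-(y ^ 2 / (2 * m)))) :=
    fun r _ => sum_tilt_le (p r) (fun σ => !G r σ && g r σ) y hy0
  have h3 := sum_card_new_le G g hG0 hGs n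
  have h4 : ∑ r ∈ range n, ∑ σ : Fin m → Bool, (if (!G r σ && g r σ) = true then
      ∑ j : Fin m, (if σ j = p r j then (1 : ℝ) else -1) else 0)
        ≤ y * 2 ^ m + n * (m * (2 ^ m * (((n : ℝ) + 1) * ((m : ℝ) + 1))⁻¹)) := by
    calc ∑ r ∈ range n, ∑ σ : Fin m → Bool, (if (!G r σ && g r σ) = true then
          ∑ j : Fin m, (if σ j = p r j then (1 : ℝ) else -1) else 0)
        ≤ ∑ r ∈ range n, (y * (((univ : Finset (Fin m → Bool)).filter
            fun σ => (!G r σ && g r σ) = true).card : ℝ)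
              + m * (2 ^ m * Real.exp (-(y ^ 2 / (2 * m))))) := sum_le_sum h2
      _ = y * ∑ r ∈ range n, (((univ : Finset (Fin m → Bool)).filter
            fun σ => (!G r σ && g r σ) = true).card : ℝ)
              + n * (m * (2 ^ m * Real.exp (-(y ^ 2 / (2 * m))))) := by
          rw [sum_add_distrib, mul_sum, sum_const, card_range, nsmul_eq_mul]
      _ ≤ y * 2 ^ m + n * (m * (2 ^ m * (((n : ℝ) + 1) * ((m : ℝ) + 1))⁻¹)) := by
          rw [hexp]
          linarith [mul_le_mul_of_nonneg_left h3 hy0]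
  -- the second term is at most `2^m`
  have h5 : (n : ℝ) * (m * (2 ^ m * (((n : ℝ) + 1) * ((m : ℝ) + 1))⁻¹)) ≤ 2 ^ m := by
    have hn0 : (0 : ℝ) ≤ n := Nat.cast_nonneg n
    have hq : (n : ℝ) * m / ((n + 1) * (m + 1)) ≤ 1 := by
      rw [div_le_one hNMpos]; nlinarith
    calc (n : ℝ) * (m * (2 ^ m * (((n : ℝ) + 1) * ((m : ℝ) + 1))⁻¹))
        = 2 ^ m * ((n : ℝ) * m / ((n + 1) * (m + 1))) := by ring
      _ ≤ 2 ^ m * 1 := mul_le_mul_of_nonneg_left hq h2m.le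
      _ = 2 ^ m := mul_one _
  -- the first term: `2y·2^m = 2√2·√L·2^m·√m ≤ 4√L·2^m·√m`, and `2·2^m ≤ 8·2^m·√m`
  have hsqrt2 : Real.sqrt 2 ≤ 2 := by
    rw [Real.sqrt_le_left (by norm_num : (0 : ℝ) ≤ 2)]; norm_num
  have hA : 0 ≤ Real.sqrt m * Real.sqrt L * 2 ^ m := by positivity
  calc (∑ σ : Fin m → Bool, ((univ.filter fun j : Fin m =>
          G n σ ≠ G n (Function.update σ j (!σ j))).card : ℝ))
      ≤ 2 * (y * 2 ^ m + 2 ^ m) := by linarith [h1, h4, h5]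
    _ = 2 * Real.sqrt 2 * (Real.sqrt m * Real.sqrt L * 2 ^ m) + 2 * 2 ^ m := by rw [hy]; ring
    _ ≤ 2 * 2 * (Real.sqrt m * Real.sqrt L * 2 ^ m) + 8 * (2 ^ m * Real.sqrt m) := by
        have e1 : 2 * Real.sqrt 2 * (Real.sqrt m * Real.sqrt L * 2 ^ m)
            ≤ 2 * 2 * (Real.sqrt m * Real.sqrt L * 2 ^ m) :=
          mul_le_mul_of_nonneg_right (by linarith) hA
        have e2 : (2 : ℝ) ^ m ≤ 2 ^ m * Real.sqrt m := le_mul_of_one_le_right h2m.le hsm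
        linarith
    _ = (4 * Real.sqrt L + 8) * (2 ^ m * Real.sqrt m) := by ring

/-! ### The chain of partial disjunctions of a `Fin K`-indexed family -/

/-- The chain step: `[∃ a < r+1, f_a σ] = [∃ a < r, f_a σ] ∨ f_r σ`, where the family is extended
to all of `ℕ` by the constant `false`. -/
theorem chain_step {K : ℕ} (f : Fin K → (Fin m → Bool) → Bool) (r : ℕ) (σ : Fin m → Bool) :
    decide (∃ a : Fin K, (a : ℕ) < r + 1 ∧ f a σ = true)
      = (decide (∃ a : Fin K, (a : ℕ) < r ∧ f a σ = true) ||
          (if h : r < K then f ⟨r, h⟩ else fun _ => false) σ) := by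
  rw [Bool.eq_iff_iff, Bool.or_eq_true, decide_eq_true_iff, decide_eq_true_iff]
  by_cases hr : r < K
  · rw [dif_pos hr]
    constructor
    · rintro ⟨a, ha, hfa⟩
      rcases Nat.lt_succ_iff_lt_or_eq.mp ha with ha | ha
      · exact Or.inl ⟨a, ha, hfa⟩
      · right
        have hra : (⟨r, hr⟩ : Fin K) = a := Fin.ext ha.symm
        rw [hra]; exact hfa
    · rintro (⟨a, ha, hfa⟩ | hfa)
      · exact ⟨a, Nat.lt_succ_of_lt ha, hfa⟩
      · exact ⟨⟨r, hr⟩, Nat.lt_succ_self r, hfa⟩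
  · rw [dif_neg hr]
    have hK : ∀ a : Fin K, (a : ℕ) < r := fun a => lt_of_lt_of_le a.isLt (not_lt.mp hr)
    constructor
    · rintro ⟨a, -, hfa⟩; exact Or.inl ⟨a, hK a, hfa⟩
    · rintro (⟨a, -, hfa⟩ | hfa)
      · exact ⟨a, Nat.lt_succ_of_lt (hK a), hfa⟩
      · exact absurd hfa (by simp)

/-- The extended family is unate (the padding `false` is unate for any orientation). -/
theorem extend_unate {K : ℕ} (f : Fin K → (Fin m → Bool) → Bool) (o : Fin K → Fin m → Bool)
    (hf : ∀ (a : Fin K) (σ : Fin m → Bool) (j : Fin m),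
      f a (Function.update σ j (!o a j)) = true → f a (Function.update σ j (o a j)) = true)
    (r : ℕ) (σ : Fin m → Bool) (j : Fin m)
    (h : (if h : r < K then f ⟨r, h⟩ else fun _ => false)
      (Function.update σ j (!(if h : r < K then o ⟨r, h⟩ else fun _ => false) j)) = true) :
    (if h : r < K then f ⟨r, h⟩ else fun _ => false)
      (Function.update σ j ((if h : r < K then o ⟨r, h⟩ else fun _ => false) j)) = true := by
  by_cases hr : r < K
  · simp only [dif_pos hr] at h ⊢
    exact hf _ σ j h
  · simp [dif_neg hr] at h

/-- At the end of the chain the guard `a < K` is vacuous. -/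
theorem chain_last {K : ℕ} (f : Fin K → (Fin m → Bool) → Bool) (σ : Fin m → Bool) :
    decide (∃ a : Fin K, (a : ℕ) < K ∧ f a σ = true) = decide (∃ a : Fin K, f a σ = true) :=
  decide_eq_decide.mpr ⟨fun ⟨a, _, ha⟩ => ⟨a, ha⟩, fun ⟨a, ha⟩ => ⟨a, a.isLt, ha⟩⟩

end KaneSens

open KaneSens in
/-- **Stub `stub_kaneSens` (line `Sketch`, v6) — Kane's Proposition 3 in counting form.** For unate
`f_0, …, f_{K-1} : {0,1}^m → {0,1}` (orientations `o_a`) and `F = ⋁_a f_a`,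
`#{(σ, j) : F(σ) ≠ F(σ^{⊕j})} ≤ (4√(log((K+1)(m+1))) + 8) · 2^m √m` (`m ≥ 1`): telescoping
`F_r = ⋁_{a<r} f_a` with Kane's one-step inequality, the sets `S_r = ¬F_r ∧ f_r` being disjoint,
and the crude level-one bound with the uniform level `y = √(2m log((K+1)(m+1)))`
(D. M. Kane, STOC 2014, arXiv:1309.2987, Proposition 3). -/
theorem stub_kaneSens {m K : ℕ} (hm : 1 ≤ m) (f : Fin K → (Fin m → Bool) → Bool)
    (o : Fin K → Fin m → Bool)
    (hf : ∀ (a : Fin K) (σ : Fin m → Bool) (j : Fin m),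
      f a (Function.update σ j (!o a j)) = true → f a (Function.update σ j (o a j)) = true) :
    (∑ σ : Fin m → Bool, ((univ.filter fun j : Fin m =>
        decide (∃ a : Fin K, f a σ = true) ≠
          decide (∃ a : Fin K, f a (Function.update σ j (!σ j)) = true)).card : ℝ))
      ≤ (4 * Real.sqrt (Real.log ((K + 1) * (m + 1))) + 8) * (2 ^ m * Real.sqrt m) := by
  have h := sens_chain_bound hm (fun (r : ℕ) (σ : Fin m → Bool) =>
      decide (∃ a : Fin K, (a : ℕ) < r ∧ f a σ = true))
    (fun r => if h : r < K then f ⟨r, h⟩ else fun _ => false)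
    (fun r => if h : r < K then o ⟨r, h⟩ else fun _ => false)
    (fun σ => by simp) (chain_step f) (extend_unate f o hf) K
  simp only [chain_last] at h
  exact h

end Summit.QuantumAdvantage.QuantumAdvantage.Theorems.LiouvilleOrthogonalTC0

end
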